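import Literature.AlgebraicGeometry.Resolution.Lipman1969RationalContraction
import Literature.AlgebraicGeometry.Resolution.ExceptionalCurveDegree
import Literature.AlgebraicGeometry.Motives.CartierDivisorOfIdealSheaf
import HarnessLib

/-!
# Intersection theory for exceptional curves: Lipman 1969, Proposition (13.1) a)–d)

Topic: `Literature/AlgebraicGeometry/Resolution`. NAMED FACTS (D-0014), typed from the printed page of
J. Lipman, *Rational singularities, with applications to algebraic surfaces and unique factorization*,
Publ. Math. IHÉS 36 (1969) 195–279, §13 "Intersection theory for exceptional curves", Proposition (13.1)
(held copy `paper:doi-10-1007-bf02684604`, PDF p. 30 = printed p. 223; §12 p. 220 and Remark 2 p. 221;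
§10 p. 212, Cor. (10.3) p. 215), in the vocabulary of `Lipman1969RationalSurfaceSingularities`
(`excCurvePoints`, `excCurveDegree f D η = (𝒪_X(D)·E_η)` — Lipman's `(D·E) := deg_E(i^*𝒪(D))` for the
INTEGRAL curve `E = E_η`), of `Lipman1969RationalContraction` (`h0 π 𝓘 = h⁰(𝒪_X/𝓘)`, the length over the
base), of `Motives/CartierDivisor*` (`CartierDivisor`, `IsEffective`, `Avoids`, and
`CartierDivisor.ofIsEffectiveCartier I hI` — the effective Cartier divisor of an invertible ideal sheaf) and
of `Resolution/Blowups`, `Resolution/PrimeDivisorIdeals` (`IsEffectiveCartier`, `primeDivisorIdeal`).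

## The source (p. 223)

§13 (pp. 222–223): "from now on, by a curve on `X` we mean a one-dimensional closed subscheme of `X` whose
defining sheaf of ideals is invertible … Let `D` be a divisor on `X`, and let `𝒪(D)` be the corresponding
invertible sheaf. Let `E` be a curve on `X`, with exceptional support (cf. §12). `𝒪(−E)` is the sheaf of
ideals defining `E`; let `𝒪_E = 𝒪_X/𝒪(−E)`. … The intersection number `(D·E)` is defined by
`(D·E) = (𝒪(D)·E) = deg_E(𝒪_E(D))` … It will be convenient to write '`h^i(E)`', '`χ(E)`' in place of
'`h^i(𝒪_E)`', '`χ(𝒪_E)`'."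

**Proposition (13.1).** "Let `D`, `D₁`, `D₂` be divisors on `X`, and let `E`, `F` be curves on `X` with
exceptional support: a) If `E` is integral, then `(D·E)` is an integer multiple of `h⁰(E)`.
b) `((D₁+D₂)·E) = (D₁·E) + (D₂·E)`; `(D·(E+F)) = (D·E) + (D·F)`. c) If `D` is effective and its support
contains no associated point of `E`, then `(D·E) ≥ 0`, and `(D·E) = 0` if and only if the supports of `D`
and `E` have no point in common. d) `(F·E) = χ(E) + χ(F) − χ(E+F) = (E·F)`." (`E + F` is the curve with
ideal `𝒪(−E)𝒪(−F)`, proof p. 223.)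

Standing context (§12 p. 219–220, §13 p. 222): `A` noetherian, `f : X → Spec A` of finite type; "exceptional
support" = support proper over `A` with zero-dimensional image; §10 p. 212: `h⁰`, `h¹`, `χ` are lengths over
`A`; §12 Remark 2 c) p. 221: "If `𝒟` is an effective divisor on `X` whose support contains no associated
point of `C`, then `(𝒪_X(𝒟)·C) = h⁰((i^*𝒟))`".

## What is vendored (REGULAR `X`, the regime of the consumers; an integral curve on a regular `X` is
## automatically a "curve" in the sense of §13 — its ideal is invertible, §14 p. 224)

All four facts are stated for `π : X → Spec S`, `S` Noetherian local, `X` integral and regular, `π` proper (so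
that the integral curves `E_η`, `η ∈ excCurvePoints π`, have exceptional support), with
`(D·E_η) := excCurveDegree π D η` for `D : CartierDivisor X` and `h⁰(E_η) := h0 π (primeDivisorIdeal η)`:

* `Lipman1969_13_1_a` — a): `(D·E_η)` is an integer multiple of `h⁰(E_η)` (no rationality needed).
* `Lipman1969_13_1_c` — c) for the integral curve `E = E_η` (its only associated point is `η`, so the
  hypothesis reads "`D` avoids `η`", `CartierDivisor.Avoids`): for `D` effective avoiding `η`,
  `(D·E_η) ≥ 0`, with equality iff `D` avoids every point of `E_η = closure {η}`. (The inequality alone is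
  the tree's THEOREM `excCurveDegree_nonneg_of_isEffective`; the equivalence is the fact.)
* `Lipman1969_13_1_d_rat` — d) `(F·E) = χ(E) + χ(F) − χ(E+F)` for integral exceptional curves `F = E_{η′}`,
  `E = E_η` (possibly `η = η′`), on a desingularization of a two-dimensional normal local domain with a
  RATIONAL singularity, where `χ = h⁰` for `𝒪_E`, `𝒪_F`, `𝒪_{E+F} = 𝒪_X/𝓘_{η′}𝓘_η` (Prop. (1.2) 2):
  `H¹(X, 𝒪_X) = 0`, and `H² = 0` on fibres of dimension `≤ 1`, p. 220 — the dictionary of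
  `Lipman1969RationalContraction`): `excCurveDegree π [E_{η′}] η = h0 𝓘_η + h0 𝓘_{η′} − h0 (𝓘_{η′}·𝓘_η)`, the
  Cartier divisor `[E_{η′}] = CartierDivisor.ofIsEffectiveCartier 𝓘_{η′} _`.
* `Lipman1969_13_1_b_rat` — b), second equation, combined with d), in the same rational regime and for
  curves `E`, `F`, `G` with exceptional support given as non-empty products of the prime ideals `𝓘_η`,
  `η ∈ excCurvePoints π` (effective exceptional divisors): writing `(A·B) := χ(A) + χ(B) − χ(A+B)` (d)) with
  `χ = h⁰`, `(E·(F+G)) = (E·F) + (E·G)`, i.e.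
  `h0 𝓘 + h0 (𝓙𝓚) − h0 (𝓘𝓙𝓚) = (h0 𝓘 + h0 𝓙 − h0 (𝓘𝓙)) + (h0 𝓘 + h0 𝓚 − h0 (𝓘𝓚))`.
  (The first equation of b), additivity in `D`, is the tree's THEOREM `excCurveDegree_add`.)

VACUITY: none of the four `Prop`s is decided by unfolding; the hypothesis blocks are those of
`Lipman1969_27_3_rat` / `Lipman1969_12_1_i` and are satisfiable (blow-up of the closed point of a regular
local ring of dimension `2`: one exceptional curve `E ≅ ℙ¹_κ`, `h⁰(E) = 1`, `(E·E) = −1 = 2·1 − 3`).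
Finite lengths: `h0` of these quotients is finite (`Lipman1969RationalContractionRegime`); the facts use
`ENat.toNat` casts to `ℤ`, exact in the regime.

## What is NOT here

The proofs; (13.1) for `X` not regular (curves = effective divisors with invertible ideal on an arbitrary
finite-type `A`-scheme); c) for non-integral curves `E`; d) and the second equation of b) outside the rational
regime (they need `χ = h⁰ − h¹` with `H¹`, cf. the (B′) vocabulary note in `Lipman1969RationalContraction`);
the symmetric form `= (E·F)` of d) as a separate statement (it is d) with `E`, `F` exchanged).
`-- TODO(general form)` lines record the printed generality. Consumers: the crux chain W4.4 of the summit
`ResolutionOfSingularities` (Galois ascent of minimality, `BC-4b`); nothing here depends on that summit.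

## References

* J. Lipman, *Rational singularities, with applications to algebraic surfaces and unique
  factorization*, Publ. Math. IHÉS 36 (1969) 195–279: §13, Prop. (13.1) (p. 223); §12 and Remark 2
  (pp. 219–221); §10 (p. 212), Cor. (10.3) (p. 215); Prop. (1.2) (p. 199). [Lipman1969]
* U. Görtz, T. Wedhorn, *Algebraic Geometry I* (2nd ed., 2020), (11.9), Remark 11.27, (13.19) (Cartier
  divisors, supports, effective Cartier divisors of invertible ideals). [GortzWedhorn2020]
-/

noncomputable section

open CategoryTheory AlgebraicGeometry TopologicalSpace IsLocalRing
open Literature.AlgebraicGeometry.Motives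

universe u

namespace Literature.AlgebraicGeometry.Resolution

/-! ## Proposition (13.1) a): `(D·E)` is a multiple of `h⁰(E)` -/

/-- NAMED FACT — **Lipman 1969, Proposition (13.1) a)**: "Let `D`, `D₁`, `D₂` be divisors on `X`, and let
`E`, `F` be curves on `X` with exceptional support: a) If `E` is integral, then `(D·E)` is an integer multiple
of `h⁰(E)`." Rendered for `π : X → Spec S` proper, `S` Noetherian local, `X` integral and REGULAR (so that
the integral exceptional curve `E = E_η`, `η ∈ excCurvePoints π`, is a curve in the sense of §13), `D` a Cartier
divisor on `X` (`Motives.CartierDivisor`): `(D·E_η) = excCurveDegree π D η` is an integer multiple of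
`h⁰(E_η) = h0 π (primeDivisorIdeal η)` (length over `S` of `H⁰(𝒪_{E_η})`, finite here). Users take
`(h : Lipman1969_13_1_a)`. [cite: Lipman1969, Proposition (13.1) a) (p. 223)] -/
def Lipman1969_13_1_a : Prop :=
  ∀ (S : Type u) [CommRing S] [IsNoetherianRing S] [IsLocalRing S] (X : Scheme.{u}) [IsIntegral X]
    [IsLocallyNoetherian X] (π : X ⟶ Spec (.of S)), IsProper π → Scheme.IsRegular X →
    ∀ (D : CartierDivisor X), ∀ η ∈ excCurvePoints π,
      ∃ m : ℤ, excCurveDegree π D η = m * ((h0 π (primeDivisorIdeal η)).toNat : ℤ)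
-- TODO(general form): Lipman states a) for every finite-type `f : X → Spec A` and every integral curve `E`
-- on `X` with invertible ideal and exceptional support (no regularity of `X`).

/-! ## Proposition (13.1) c): positivity and disjointness -/

/-- NAMED FACT — **Lipman 1969, Proposition (13.1) c)**: "If `D` is effective and its support contains no
associated point of `E`, then `(D·E) ≥ 0`, and `(D·E) = 0` if and only if the supports of `D` and `E` have
no point in common." Rendered for the INTEGRAL curve `E = E_η` (its only associated point is its generic
point `η`, so the hypothesis is "`D` avoids `η`", `CartierDivisor.Avoids`) on `π : X → Spec S` proper,
`S` Noetherian local, `X` integral and regular, `D` an effective Cartier divisor (`CartierDivisor.IsEffective`):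
`0 ≤ excCurveDegree π D η`, and `excCurveDegree π D η = 0` iff `D` avoids every point of
`E_η = closure {η}` ("the supports have no point in common"). The inequality is also the tree's theorem
`excCurveDegree_nonneg_of_isEffective`. Users take `(h : Lipman1969_13_1_c)`.
[cite: Lipman1969, Proposition (13.1) c) (p. 223)] -/
def Lipman1969_13_1_c : Prop :=
  ∀ (S : Type u) [CommRing S] [IsNoetherianRing S] [IsLocalRing S] (X : Scheme.{u}) [IsIntegral X]
    [IsLocallyNoetherian X] (π : X ⟶ Spec (.of S)), IsProper π → Scheme.IsRegular X →
    ∀ (D : CartierDivisor X), D.IsEffective → ∀ η ∈ excCurvePoints π, D.Avoids η →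
      0 ≤ excCurveDegree π D η ∧
        (excCurveDegree π D η = 0 ↔ ∀ x ∈ closure ({η} : Set X), D.Avoids x)
-- TODO(general form): Lipman states c) for every curve `E` (effective divisor with one-dimensional
-- exceptional support, not necessarily integral) whose associated points are avoided by `Supp D`.

/-! ## Proposition (13.1) d), rational regime: `(F·E) = χ(E) + χ(F) − χ(E+F)` with `χ = h⁰` -/

/-- NAMED FACT — **Lipman 1969, Proposition (13.1) d), over a rational surface singularity, in
`h⁰`-lengths**: "d) `(F·E) = χ(E) + χ(F) − χ(E+F) = (E·F)`" for curves `E`, `F` on `X` with exceptional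
support (`E + F` the curve with ideal `𝒪(−E)𝒪(−F)`). Rendered for a desingularization `π : X → Spec S`
(`IsResolution`, `X` integral and regular) of a two-dimensional normal Noetherian local domain `S` with a
RATIONAL singularity and two integral exceptional curves `F = E_{η′}`, `E = E_η` (`η, η′ ∈ excCurvePoints π`,
possibly equal): there `χ = h⁰` for `𝒪_E`, `𝒪_F`, `𝒪_{E+F}` (Prop. (1.2) 2) and `H² = 0` on fibres of
dimension `≤ 1`, the dictionary of `Lipman1969RationalContraction`), `(F·E) := (𝒪(F)·E) = excCurveDegree π [F] η`
with `[F]` the effective Cartier divisor of the invertible ideal `𝓘_{η′} = primeDivisorIdeal η′`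
(`CartierDivisor.ofIsEffectiveCartier`, for any proof `hF` of invertibility — it holds on the regular `X`),
and the statement reads `excCurveDegree π [F] η = h0 π 𝓘_η + h0 π 𝓘_{η′} − h0 π (𝓘_{η′} * 𝓘_η)`. For `η = η′`
this is `(E·E) = 2h⁰(E) − h⁰(2E)`. WITHOUT `HasRationalSingularity S` the right-hand side is not Lipman's
`χ(E) + χ(F) − χ(E+F)`. Users take `(h : Lipman1969_13_1_d_rat)`.
[cite: Lipman1969, Proposition (13.1) d) (p. 223)] -/
def Lipman1969_13_1_d_rat : Prop :=
  ∀ (S : Type u) [CommRing S] [IsNoetherianRing S] [IsLocalRing S] [IsDomain S]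
    [IsIntegrallyClosed S], ringKrullDim S = 2 → HasRationalSingularity S →
    ∀ (X : Scheme.{u}) [IsIntegral X] [IsLocallyNoetherian X] (π : X ⟶ Spec (.of S)),
      IsResolution π →
    ∀ η ∈ excCurvePoints π, ∀ η' ∈ excCurvePoints π,
      ∀ (hF : IsEffectiveCartier (primeDivisorIdeal η')),
        excCurveDegree π (CartierDivisor.ofIsEffectiveCartier (primeDivisorIdeal η') hF) η =
          ((h0 π (primeDivisorIdeal η)).toNat : ℤ) + ((h0 π (primeDivisorIdeal η')).toNat : ℤ) -
            ((h0 π (primeDivisorIdeal η' * primeDivisorIdeal η)).toNat : ℤ)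
-- TODO(general form): Lipman proves d) for all curves `E`, `F` with exceptional support on any
-- finite-type `X → Spec A`, with `χ = h⁰ − h¹` (no rationality, no regularity, lengths over `A`).

/-! ## Proposition (13.1) b) (second equation) with d), rational regime: bi-additivity in the curve -/

/-- NAMED FACT — **Lipman 1969, Proposition (13.1) b) (second equation) combined with d), over a rational
surface singularity, in `h⁰`-lengths**: "b) … `(D·(E+F)) = (D·E) + (D·F)`" together with "d)
`(F·E) = χ(E) + χ(F) − χ(E+F)`", for curves with exceptional support. Rendered for a desingularization
`π : X → Spec S` of a two-dimensional normal Noetherian local domain `S` with a RATIONAL singularity and three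
curves `E`, `F`, `G` with exceptional support given by NON-EMPTY finite products `𝓘`, `𝓙`, `𝓚` of the prime
ideals `primeDivisorIdeal η`, `η ∈ excCurvePoints π` (effective exceptional divisors on the regular `X`;
`(s.map primeDivisorIdeal).prod` for a non-zero multiset `s`): with `(A·B) := χ(A) + χ(B) − χ(A+B)` (d)) and
`χ = h⁰ = h0 π ·` for all these quotients (rational regime, as in `Lipman1969_13_1_d_rat`), the identity
`(E·(F+G)) = (E·F) + (E·G)` reads
`h0 𝓘 + h0 (𝓙𝓚) − h0 (𝓘𝓙𝓚) = (h0 𝓘 + h0 𝓙 − h0 (𝓘𝓙)) + (h0 𝓘 + h0 𝓚 − h0 (𝓘𝓚))` (integers, `ENat.toNat`).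
The first equation of b) (additivity in the divisor) is the tree's theorem `excCurveDegree_add`. Users take
`(h : Lipman1969_13_1_b_rat)`. [cite: Lipman1969, Proposition (13.1) b) and d) (p. 223)] -/
def Lipman1969_13_1_b_rat : Prop :=
  ∀ (S : Type u) [CommRing S] [IsNoetherianRing S] [IsLocalRing S] [IsDomain S]
    [IsIntegrallyClosed S], ringKrullDim S = 2 → HasRationalSingularity S →
    ∀ (X : Scheme.{u}) (π : X ⟶ Spec (.of S)), IsResolution π →
    ∀ (s t u : Multiset X), s ≠ 0 → t ≠ 0 → u ≠ 0 →
      (∀ η ∈ s, η ∈ excCurvePoints π) → (∀ η ∈ t, η ∈ excCurvePoints π) →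
      (∀ η ∈ u, η ∈ excCurvePoints π) →
      let 𝓘 : X.IdealSheafData := (s.map primeDivisorIdeal).prod
      let 𝓙 : X.IdealSheafData := (t.map primeDivisorIdeal).prod
      let 𝓚 : X.IdealSheafData := (u.map primeDivisorIdeal).prod
      ((h0 π 𝓘).toNat : ℤ) + ((h0 π (𝓙 * 𝓚)).toNat : ℤ) - ((h0 π (𝓘 * 𝓙 * 𝓚)).toNat : ℤ) =
        (((h0 π 𝓘).toNat : ℤ) + ((h0 π 𝓙).toNat : ℤ) - ((h0 π (𝓘 * 𝓙)).toNat : ℤ)) +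
          (((h0 π 𝓘).toNat : ℤ) + ((h0 π 𝓚).toNat : ℤ) - ((h0 π (𝓘 * 𝓚)).toNat : ℤ))
-- TODO(general form): Lipman's b) is `((D₁+D₂)·E) = (D₁·E)+(D₂·E)` and `(D·(E+F)) = (D·E)+(D·F)` for
-- arbitrary divisors `D` and curves `E`, `F` with exceptional support, `χ = h⁰ − h¹`, any finite-type base.

end Literature.AlgebraicGeometry.Resolution

end
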